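/-
Copyright (c) 2026 the pub-hodgecm-mathlib formalisation cell (harness21).  Prover seat hodgecm-mathlib-LH5-p02 (g11): E1 row 23 «FIXED-VECTOR GENERATION»
(E1 keeper ∕ dealer F0P3a-p03 (g29), LEAD F0P3a-plan T14-67 rule 20), 2026-09-03.
-/
import Literature.NumberTheory.Automorphic.HeckeFixedVectorsSpan   -- ★ `span_translates_fixedPoints_eq_top`, ★ `map_span_translates_le`, ★ `le_span_translates`; brings `Representation.fixedPoints`
import Mathlib.LinearAlgebra.DFinsupp
import Mathlib.LinearAlgebra.Dimension.Finrank
import HarnessLib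

/-!
# Fixed vectors under conjugate subgroups; an irreducible is the sum of its `V^{gKg⁻¹}` (the augmentation of the Schneider–Stuhler complex is onto)

Topic `NumberTheory/Automorphic` (declarations in Mathlib's `Representation` namespace, as deliberate dot-notation extensions next to
★ `Representation.fixedPoints`; THEOREMS ONLY — no definition, instance, notation or named fact).  Cell `pub/hodgecm-mathlib`
(D-0151), crux H413 = `stmt-HodgeConjecture-24833`, lane `--supports`; E1 census «KAZHDAN-IN-HOUSE» v1 §2-K1 (R) («surjectivity of the
augmentation `ε : ⊕_x V^{U_x^{(e)}} → V`»), E1 LEDGER row 23.  Count-neutral generic base layer of the (R-SS) engine; HC_CM is proved only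
modulo the 7 printed citations (2 remaining named inputs: hLiu418 = `stmt-HodgeConjecture-24832`, h413 = `stmt-HodgeConjecture-24833`) until
rung 0 closes.

For a representation `ρ` of a group `G` on a `k`-module `V` and a subgroup `K ≤ G` write `V^K = ρ.fixedPoints K` and `ᵍK = gKg⁻¹ =
K.map (MulAut.conj g)`.

* §1 CONJUGATION TRANSPORT (any commutative `k`): `ρ(g) v ∈ V^{ᵍK} ↔ v ∈ V^K` (`mem_fixedPoints_map_conj_iff`), `ρ(g⁻¹) w ∈ V^K ↔ w ∈ V^{ᵍK}`,
  **`ρ(g)(V^K) = V^{ᵍK}`** (`map_fixedPoints_eq_fixedPoints_map_conj`, the «onto» of row 23 (i); generalises the `ℂ`-only membership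
  ★ `Literature.NumberTheory.Automorphic.apply_mem_fixedPoints_map_conj` of `JacquetGLGeneration`), `V^{ᵍK} ≠ 0 ↔ V^K ≠ 0`, a `k`-linear
  `V^K ≃ V^{ᵍK}` through `ρ(g)` and `finrank V^{ᵍK} = finrank V^K`.
* §2 SPANS OF TRANSLATES AS SUPREMA: **`⨆_g V^{ᵍK} = span_k ⋃_g ρ(g)(V^K)`** (`iSup_fixedPoints_map_conj_eq_span_translates`); for a family
  `U : ι → Subgroup G` through which every conjugate of `K` factors (`∀ g, ∃ i, U i ≤ ᵍK`) the span of translates lies in `⨆_i V^{U_i}`; a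
  conjugation-stable family has a `G`-stable `⨆_i V^{U_i}`.  (The `G`-stability of the span of translates itself is ★ `map_span_translates_le`.)
* §3 GENERATION (`k` a field): for `ρ` IRREDUCIBLE with `V^K ≠ 0`, **`⨆_g V^{ᵍK} = V`** (`iSup_fixedPoints_map_conj_eq_top`, from ★
  `span_translates_fixedPoints_eq_top`), hence `⨆_i V^{U_i} = V` for every family as above (indexed, set, and `G`-EQUIVARIANT forms — the last is
  the shape of the vertex ∕ facet stabilisers `U_x^{(e)}`, `U_{g·x} = ᵍU_x`, of the Schneider–Stuhler complex), and the AUGMENTATION IS ONTO: every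
  `v` is a finite sum `Σ_i v_i` with `v_i ∈ V^{U_i}` (`exists_finsupp_mem_fixedPoints_sum_eq`).  The same conclusions from the weaker hypothesis
  «`V` is generated by `V^K`» (`span_k ⋃_g ρ(g)(V^K) = V`, any commutative `k`, no irreducibility).

## References
* [BernsteinZelevinsky1976] I. N. Bernstein, A. V. Zelevinsky, *Representations of the group `GL(n,F)` where `F` is a non-archimedean local
  field*, Russian Math. Surveys 31 (1976), §2.1 (fixed vectors, `π(g) V^K = V^{gKg⁻¹}`).
* [Bump1997] D. Bump, *Automorphic Forms and Representations* (1997), Prop. 4.2.3 p. 427 (an irreducible with `V^K ≠ 0` is generated by `V^K`).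
* [SchneiderStuhler1997] P. Schneider, U. Stuhler, *Representation theory and sheaves on the Bruhat–Tits building*, Publ. Math. IHÉS 85 (1997),
  §II.3 (the coefficient system `x ↦ V^{U_x^{(e)}}` and the exactness of its augmented chain complex; here: exactness at `V`).
-/

set_option autoImplicit false

noncomputable section

namespace Representation

open Literature.NumberTheory.Automorphic

/-! ## §1 Conjugation transport of fixed vectors -/

section Conj

variable {k G V : Type*} [CommRing k] [Group G] [AddCommGroup V] [Module k V] (ρ : Representation k G V)

/-- **`ρ(g) v ∈ V^{gKg⁻¹} ↔ v ∈ V^K`.** [cite: BernsteinZelevinsky1976, §2.1] -/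
theorem mem_fixedPoints_map_conj_iff (K : Subgroup G) (g : G) (v : V) :
    ρ g v ∈ ρ.fixedPoints (K.map (MulAut.conj g).toMonoidHom) ↔ v ∈ ρ.fixedPoints K := by
  rw [mem_fixedPoints, mem_fixedPoints]
  constructor
  · intro h x hx
    have h' := h (g * x * g⁻¹) ⟨x, hx, rfl⟩
    rw [← Module.End.mul_apply, ← map_mul, show g * x * g⁻¹ * g = g * x by group, map_mul, Module.End.mul_apply] at h'
    have hinj : Function.Injective (ρ g) := fun a b hab => by
      simpa [← Module.End.mul_apply, ← map_mul] using congrArg (ρ g⁻¹) hab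
    exact hinj h'
  · rintro h _ ⟨x, hx, rfl⟩
    rw [MulEquiv.coe_toMonoidHom, MulAut.conj_apply, ← Module.End.mul_apply, ← map_mul, mul_assoc, inv_mul_cancel, mul_one,
      map_mul, Module.End.mul_apply, h x hx]

/-- **`ρ(g⁻¹) w ∈ V^K ↔ w ∈ V^{gKg⁻¹}`.** [cite: BernsteinZelevinsky1976, §2.1] -/
theorem apply_inv_mem_fixedPoints_iff (K : Subgroup G) (g : G) (w : V) :
    ρ g⁻¹ w ∈ ρ.fixedPoints K ↔ w ∈ ρ.fixedPoints (K.map (MulAut.conj g).toMonoidHom) := by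
  rw [← ρ.mem_fixedPoints_map_conj_iff K g (ρ g⁻¹ w), ← Module.End.mul_apply, ← map_mul, mul_inv_cancel, map_one,
    Module.End.one_apply]

/-- **`ρ(g)(V^K) = V^{gKg⁻¹}`** — translation by `g` maps the `K`-fixed vectors ONTO the `gKg⁻¹`-fixed vectors.
[cite: BernsteinZelevinsky1976, §2.1] -/
theorem map_fixedPoints_eq_fixedPoints_map_conj (K : Subgroup G) (g : G) :
    (ρ.fixedPoints K).map (ρ g) = ρ.fixedPoints (K.map (MulAut.conj g).toMonoidHom) := by
  ext w
  constructor
  · rintro ⟨v, hv, rfl⟩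
    exact (ρ.mem_fixedPoints_map_conj_iff K g v).2 hv
  · intro hw
    refine ⟨ρ g⁻¹ w, (ρ.apply_inv_mem_fixedPoints_iff K g w).2 hw, ?_⟩
    rw [← Module.End.mul_apply, ← map_mul, mul_inv_cancel, map_one, Module.End.one_apply]

/-- `V^{gKg⁻¹} ≠ 0 ↔ V^K ≠ 0`. [cite: BernsteinZelevinsky1976, §2.1] -/
theorem fixedPoints_map_conj_ne_bot_iff (K : Subgroup G) (g : G) :
    ρ.fixedPoints (K.map (MulAut.conj g).toMonoidHom) ≠ ⊥ ↔ ρ.fixedPoints K ≠ ⊥ := by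
  rw [← ρ.map_fixedPoints_eq_fixedPoints_map_conj K g, not_iff_not]
  constructor
  · intro h
    rw [eq_bot_iff]
    intro v hv
    have hv' : ρ g v ∈ (ρ.fixedPoints K).map (ρ g) := Submodule.mem_map_of_mem hv
    rw [h, Submodule.mem_bot] at hv'
    have : v = ρ g⁻¹ (ρ g v) := by rw [← Module.End.mul_apply, ← map_mul, inv_mul_cancel, map_one, Module.End.one_apply]
    rw [Submodule.mem_bot, this, hv', map_zero]
  · intro h
    rw [h, Submodule.map_bot]

/-- **`V^K ≃ₗ V^{gKg⁻¹}` through `ρ(g)`** (a `k`-linear isomorphism; existence form, no definition). [cite: BernsteinZelevinsky1976, §2.1] -/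
theorem exists_linearEquiv_fixedPoints_map_conj (K : Subgroup G) (g : G) :
    ∃ e : ρ.fixedPoints K ≃ₗ[k] ρ.fixedPoints (K.map (MulAut.conj g).toMonoidHom), ∀ v, (e v : V) = ρ g v := by
  let f : ρ.fixedPoints K →ₗ[k] ρ.fixedPoints (K.map (MulAut.conj g).toMonoidHom) :=
    ((ρ g).domRestrict (ρ.fixedPoints K)).codRestrict _ fun v => (ρ.mem_fixedPoints_map_conj_iff K g v).2 v.2
  let f' : ρ.fixedPoints (K.map (MulAut.conj g).toMonoidHom) →ₗ[k] ρ.fixedPoints K :=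
    ((ρ g⁻¹).domRestrict _).codRestrict _ fun w => (ρ.apply_inv_mem_fixedPoints_iff K g w).2 w.2
  refine ⟨LinearEquiv.ofLinear f f' ?_ ?_, fun v => rfl⟩
  · ext w
    change ρ g (ρ g⁻¹ (w : V)) = w
    rw [← Module.End.mul_apply, ← map_mul, mul_inv_cancel, map_one, Module.End.one_apply]
  · ext v
    change ρ g⁻¹ (ρ g (v : V)) = v
    rw [← Module.End.mul_apply, ← map_mul, inv_mul_cancel, map_one, Module.End.one_apply]

/-- `finrank V^{gKg⁻¹} = finrank V^K` (the dimension of the fixed vectors is constant along a conjugacy class of subgroups — e.g. along a `G`-orbit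
of vertices of the building). [cite: BernsteinZelevinsky1976, §2.1] -/
theorem finrank_fixedPoints_map_conj (K : Subgroup G) (g : G) :
    Module.finrank k (ρ.fixedPoints (K.map (MulAut.conj g).toMonoidHom)) = Module.finrank k (ρ.fixedPoints K) := by
  obtain ⟨e, -⟩ := ρ.exists_linearEquiv_fixedPoints_map_conj K g
  exact e.finrank_eq.symm

end Conj

/-! ## §2 Spans of translates as suprema of conjugate-fixed subspaces -/

section Span

variable {k G V : Type*} [CommRing k] [Group G] [AddCommGroup V] [Module k V] (ρ : Representation k G V)

/-- **`⨆_g V^{gKg⁻¹} = span_k ⋃_g ρ(g)(V^K)`**: the sum of the fixed subspaces of all conjugates of `K` is the span of the translates of `V^K`.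
[cite: BernsteinZelevinsky1976, §2.1] [cite: Bump1997, Prop. 4.2.3 (proof)] -/
theorem iSup_fixedPoints_map_conj_eq_span_translates (K : Subgroup G) :
    ⨆ g : G, ρ.fixedPoints (K.map (MulAut.conj g).toMonoidHom) = Submodule.span k (⋃ g : G, ρ g '' (ρ.fixedPoints K : Set V)) := by
  rw [Submodule.span_iUnion]
  refine iSup_congr fun g => ?_
  rw [← ρ.map_fixedPoints_eq_fixedPoints_map_conj K g, Submodule.span_image, Submodule.span_eq]

/-- If every conjugate `gKg⁻¹` contains some member `U i` of a family of subgroups, the span of the translates of `V^K` lies in `⨆_i V^{U_i}`.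
[cite: SchneiderStuhler1997, §II.3] -/
theorem span_translates_fixedPoints_le_iSup {ι : Sort*} (K : Subgroup G) (U : ι → Subgroup G)
    (hU : ∀ g : G, ∃ i, U i ≤ K.map (MulAut.conj g).toMonoidHom) :
    Submodule.span k (⋃ g : G, ρ g '' (ρ.fixedPoints K : Set V)) ≤ ⨆ i, ρ.fixedPoints (U i) := by
  rw [← ρ.iSup_fixedPoints_map_conj_eq_span_translates K]
  refine iSup_le fun g => ?_
  obtain ⟨i, hi⟩ := hU g
  exact (ρ.fixedPoints_antitone hi).trans (le_iSup (fun i => ρ.fixedPoints (U i)) i)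

/-- A CONJUGATION-STABLE family of subgroups (`∀ g i, ∃ j, U j ≤ g (U i) g⁻¹`) has a `G`-stable `⨆_i V^{U_i}`. [cite: SchneiderStuhler1997, §II.3] -/
theorem map_iSup_fixedPoints_le {ι : Sort*} (U : ι → Subgroup G) (hU : ∀ (g : G) (i : ι), ∃ j, U j ≤ (U i).map (MulAut.conj g).toMonoidHom)
    (g : G) : (⨆ i, ρ.fixedPoints (U i)).map (ρ g) ≤ ⨆ i, ρ.fixedPoints (U i) := by
  rw [Submodule.map_iSup]
  refine iSup_le fun i => ?_
  obtain ⟨j, hj⟩ := hU g i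
  rw [ρ.map_fixedPoints_eq_fixedPoints_map_conj (U i) g]
  exact (ρ.fixedPoints_antitone hj).trans (le_iSup (fun i => ρ.fixedPoints (U i)) j)

/-- If `V` is GENERATED by `V^K` (`span_k ⋃_g ρ(g)(V^K) = V`; any commutative `k`, no irreducibility) then `⨆_i V^{U_i} = V` for every family
through which all conjugates of `K` factor. [cite: SchneiderStuhler1997, §II.3] -/
theorem iSup_fixedPoints_eq_top_of_span_translates_eq_top {ι : Sort*} (K : Subgroup G) (U : ι → Subgroup G)
    (hU : ∀ g : G, ∃ i, U i ≤ K.map (MulAut.conj g).toMonoidHom)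
    (hgen : Submodule.span k (⋃ g : G, ρ g '' (ρ.fixedPoints K : Set V)) = ⊤) :
    ⨆ i, ρ.fixedPoints (U i) = ⊤ :=
  top_unique (hgen ▸ ρ.span_translates_fixedPoints_le_iSup K U hU)

/-- Membership in `⨆_i V^{U_i}` as a FINITE SUM `Σ_i v_i`, `v_i ∈ V^{U_i}` (the augmentation of `⊕_i V^{U_i}` hits exactly `⨆_i V^{U_i}`). [cite: SchneiderStuhler1997, §II.3] -/
theorem exists_finsupp_mem_fixedPoints_sum_eq_of_mem_iSup {ι : Type*} (U : ι → Subgroup G) {v : V}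
    (hv : v ∈ ⨆ i, ρ.fixedPoints (U i)) :
    ∃ f : ι →₀ V, (∀ i, f i ∈ ρ.fixedPoints (U i)) ∧ (f.sum fun _ w => w) = v :=
  (Submodule.mem_iSup_iff_exists_finsupp _ v).1 hv

end Span

/-! ## §3 Generation: an irreducible with `V^K ≠ 0` is the sum of its `V^{gKg⁻¹}` -/

section Generation

variable {k G V : Type*} [Field k] [Group G] [AddCommGroup V] [Module k V] (ρ : Representation k G V)

/-- **`⨆_g V^{gKg⁻¹} = V` for an IRREDUCIBLE `ρ` with `V^K ≠ 0`** (the supremum form of ★ `span_translates_fixedPoints_eq_top`).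
[cite: Bump1997, Prop. 4.2.3] [cite: BernsteinZelevinsky1976, §2.1] -/
theorem iSup_fixedPoints_map_conj_eq_top (K : Subgroup G) [ρ.IsIrreducible] (hne : ρ.fixedPoints K ≠ ⊥) :
    ⨆ g : G, ρ.fixedPoints (K.map (MulAut.conj g).toMonoidHom) = ⊤ := by
  rw [ρ.iSup_fixedPoints_map_conj_eq_span_translates K]
  exact span_translates_fixedPoints_eq_top ρ K hne

/-- **`⨆_i V^{U_i} = V`** for an irreducible `ρ` with `V^K ≠ 0` and a family `U` through which every conjugate of `K` factors (`∀ g, ∃ i, U i ≤ gKg⁻¹`).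
[cite: SchneiderStuhler1997, §II.3] [cite: Bump1997, Prop. 4.2.3] -/
theorem iSup_fixedPoints_eq_top_of_forall_exists_le {ι : Sort*} (K : Subgroup G) (U : ι → Subgroup G)
    (hU : ∀ g : G, ∃ i, U i ≤ K.map (MulAut.conj g).toMonoidHom) [ρ.IsIrreducible] (hne : ρ.fixedPoints K ≠ ⊥) :
    ⨆ i, ρ.fixedPoints (U i) = ⊤ :=
  ρ.iSup_fixedPoints_eq_top_of_span_translates_eq_top K U hU (span_translates_fixedPoints_eq_top ρ K hne)

/-- **SET-FAMILY FORM**: for a set `𝒦` of subgroups containing every conjugate of `K`, `⨆_{K′ ∈ 𝒦} V^{K′} = V` (`ρ` irreducible, `V^K ≠ 0`).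
[cite: SchneiderStuhler1997, §II.3] [cite: Bump1997, Prop. 4.2.3] -/
theorem biSup_fixedPoints_eq_top_of_map_conj_mem (K : Subgroup G) {𝒦 : Set (Subgroup G)}
    (h𝒦 : ∀ g : G, K.map (MulAut.conj g).toMonoidHom ∈ 𝒦) [ρ.IsIrreducible] (hne : ρ.fixedPoints K ≠ ⊥) :
    ⨆ K' ∈ 𝒦, ρ.fixedPoints K' = ⊤ := by
  refine top_unique ?_
  rw [← ρ.iSup_fixedPoints_map_conj_eq_top K hne]
  exact iSup_le fun g => le_biSup (fun K' => ρ.fixedPoints K') (h𝒦 g)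

/-- **EQUIVARIANT-FAMILY FORM** (the vertex ∕ facet stabilisers of the Schneider–Stuhler complex): `G` acts on an index type `X`, `U : X → Subgroup G`
satisfies `U (g • x) = g (U x) g⁻¹`, and `V^{U x₀} ≠ 0` for some `x₀`; then `⨆_x V^{U x} = V` for `ρ` irreducible. [cite: SchneiderStuhler1997, §II.3] -/
theorem iSup_fixedPoints_eq_top_of_equivariant {X : Type*} [MulAction G X] (U : X → Subgroup G)
    (hU : ∀ (g : G) (x : X), U (g • x) = (U x).map (MulAut.conj g).toMonoidHom) (x₀ : X) [ρ.IsIrreducible]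
    (hne : ρ.fixedPoints (U x₀) ≠ ⊥) : ⨆ x, ρ.fixedPoints (U x) = ⊤ :=
  ρ.iSup_fixedPoints_eq_top_of_forall_exists_le (U x₀) U (fun g => ⟨g • x₀, (hU g x₀).le⟩) hne

/-- **THE AUGMENTATION IS ONTO**: for `ρ` irreducible with `V^K ≠ 0` and a family `U` through which all conjugates of `K` factor, every `v ∈ V` is a
finite sum `Σ_i v_i` with `v_i ∈ V^{U_i}` — exactness at `V` of the augmented complex `⋯ → ⊕_i V^{U_i} → V → 0`. [cite: SchneiderStuhler1997, §II.3] -/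
theorem exists_finsupp_mem_fixedPoints_sum_eq {ι : Type*} (K : Subgroup G) (U : ι → Subgroup G)
    (hU : ∀ g : G, ∃ i, U i ≤ K.map (MulAut.conj g).toMonoidHom) [ρ.IsIrreducible] (hne : ρ.fixedPoints K ≠ ⊥) (v : V) :
    ∃ f : ι →₀ V, (∀ i, f i ∈ ρ.fixedPoints (U i)) ∧ (f.sum fun _ w => w) = v :=
  ρ.exists_finsupp_mem_fixedPoints_sum_eq_of_mem_iSup U
    ((ρ.iSup_fixedPoints_eq_top_of_forall_exists_le K U hU hne).symm ▸ Submodule.mem_top)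

/-- The augmentation `⊕_i V^{U_i} → V`, `(v_i) ↦ Σ v_i`, as the linear map `DFinsupp.lsum`, is SURJECTIVE (same hypotheses). [cite: SchneiderStuhler1997, §II.3] -/
theorem lsum_fixedPoints_surjective {ι : Type*} [DecidableEq ι] (K : Subgroup G) (U : ι → Subgroup G)
    (hU : ∀ g : G, ∃ i, U i ≤ K.map (MulAut.conj g).toMonoidHom) [ρ.IsIrreducible] (hne : ρ.fixedPoints K ≠ ⊥) :
    Function.Surjective (DFinsupp.lsum ℕ fun i => (ρ.fixedPoints (U i)).subtype) := by
  rw [← LinearMap.range_eq_top, ← Submodule.iSup_eq_range_dfinsupp_lsum]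
  exact ρ.iSup_fixedPoints_eq_top_of_forall_exists_le K U hU hne

end Generation

end Representation

end
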